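import Literature.Analysis.Hypoelliptic.HormanderProof
import HarnessLib

/-!
# Hypoellipticity of square systems with diagonal Hörmander principal part and zeroth-order coupling

Analysis/Hypoelliptic: Kohn's Fourier-side bootstrap (M. E. Taylor, *Pseudodifferential Operators*
(1981), Ch. XV §1), as assembled in `HormanderProof.lean` for ONE operator
`P = ∑_j X_j² + X₀ + c` (L. Hörmander, Acta Math. 119 (1967), Thm 1.1), run JOINTLY over the
components of a square system
`P_w u_w = f_w + ∑_{w'} a_{w w'} u_{w'}` (`w ∈ W` finite), each `P_w` a Hörmander operator
satisfying the bracket condition, the coupling `a` constant (zeroth order). Such systems are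
hypoelliptic: the principal part is diagonal and subelliptic, and the coupling costs no
derivatives (B. Helffer, F. Nier, *Hypoelliptic Estimates and Spectral Theory for Fokker–Planck
Operators and Witten Laplacians*, LNM 1862 (2005), §2; L. Hörmander, *The Analysis of Linear
Partial Differential Operators III*, §22.2). The motivating instance is a kinetic Fokker–Planck
operator perturbed by a finite group of measure-preserving linear symmetries
(`u ↦ ∑_k a_k u ∘ A_k`): the conjugates `u ∘ A_w` solve such a system.

* `FlatHData.XLink.pairing_Pf_eq_uC_add`, `Pf_ae_eq_add`, **`inH_Pf_of_cutoff_add`** — the key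
  identity (`KeyIdentity.lean`) with an extra functional `Λ` represented on the Fourier side by
  `H`: `Pf G ∈ Ĥ^t` as soon as `G', Xf_j G', H ∈ Ĥ^t`;
* `uC_add_distrib`, `uC_smul_distrib`, `uC_sum_smul_distrib` — `uC` is linear in the distribution;
* **`Chart.hPu_add`** — the hypothesis of the coupled key identity from the coupled equation
  `u (ᵗPφ) = ∫ f φ dμ + v φ` (the cutoff, not the distribution, has to sit in the chart);
* **`exists_chartAt`** — the chart data of `HormanderProof.exists_chart_nhds` at a point;
* **`isSmoothOn_ball_coupled`**, **`isSmoothOn_of_coupledSystem`**,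
  **`exists_smooth_ae_eq_of_coupledSystem`** — the joint bootstrap and the hypoellipticity of the
  coupled system (distributions on `Ω`, resp. locally integrable functions on `E`).

## References

* L. Hörmander, *Hypoelliptic second order differential equations*, Acta Math. 119 (1967), Thm 1.1.
* J. J. Kohn, *Pseudo-differential operators and hypoellipticity*, Proc. Sympos. Pure Math. 23
  (1973) 61–69; M. E. Taylor, *Pseudodifferential Operators* (1981), Ch. XV §1.
* B. Helffer, F. Nier, LNM 1862 (2005), §2 (systems with scalar principal part).
-/

noncomputable section

open MeasureTheory Set Filter Function SchwartzMap VectorField Metric TopologicalSpace Distributions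
  TestFunction Module
open scoped ENNReal NNReal Topology ComplexConjugate InnerProductSpace FourierTransform BigOperators
  ContDiff

namespace Literature.Analysis.Hypoelliptic

open Literature.Analysis.Distribution

variable {E : Type*} [NormedAddCommGroup E] [NormedSpace ℝ E]
variable {V : Type*} [NormedAddCommGroup V] [InnerProductSpace ℝ V] [FiniteDimensional ℝ V]
  [MeasurableSpace V] [BorelSpace V]

/-! ### The key identity with a coupling term -/

namespace FlatHData.XLink

variable {Ω : Opens E} {J : ℕ} {fd : FlatHData V J} {T : E ≃L[ℝ] V} (xl : fd.XLink T)
variable {u : 𝓓'(Ω, ℝ)} {ζ ζ' : 𝓓(Ω, ℝ)}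

/-- **The raw key identity** (everything in `pairing_Pf_eq` except the equation `P u = F`): for
`G` representing `id` w.r.t. `ζ`, `G'` w.r.t. `ζ'` (`ζ' ζ = ζ`), Schwartz avatars `bη j` of `X^j ζ`
and `bm` of `m`, and `h = conj ∘ 𝓕ψ ∘ T`:
`pairing (Pf G) ψ = uC u ζ' (PfC (ζ h)) + pairing (-2 ∑_j conv_{η_j} (Xf_j G') + conv_m G') ψ`.
[folklore] -/
theorem pairing_Pf_eq_uC_add {G G' : V → ℂ} (hG : Rep u ζ (T : E →L[ℝ] V) G id)
    (hG' : Rep u ζ' (T : E →L[ℝ] V) G' id)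
    (hζ : ∀ x, ζ' x * ζ x = ζ x)
    (bη : Fin J → 𝓢(V, ℂ)) (hbη : ∀ j x, (xl.Xap j ζ x : ℂ) = bη j (T x))
    (bm : 𝓢(V, ℂ)) (hbm : ∀ x, (xl.mcoef ζ x : ℂ) = bm (T x)) (ψ : 𝓢(V, ℂ)) :
    pairing (fd.Pf G) ψ =
      uC u ζ' (xl.PfC (mulC ζ fun x => conj (𝓕 ψ ((T : E →L[ℝ] V) x)))) +
      pairing (fun ξ => (-2) * (∑ j, kerOp (convKer (thetaOf (bη j))) (fd.Xf j G') ξ) +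
        kerOp (convKer (thetaOf bm)) G' ξ) ψ := by
  set h : E → ℂ := fun x => conj (𝓕 ψ ((T : E →L[ℝ] V) x)) with hh
  have hhs : ContDiff ℝ ∞ h := contDiff_conj_fourier_comp _ ψ
  -- the left side through the shadow of `Pf`
  have hP := (hG.Pf xl).eq ψ
  simp only [id] at hP
  rw [hP]
  change uC u ζ (xl.PfC h) = _
  -- change cutoff and expand the commutator
  rw [uC_cutoff u hζ (xl.contDiff_PfC hhs)]
  have ecut : mulC ζ (xl.PfC h) = fun x => (ζ x : ℂ) * xl.PfC h x := rfl
  rw [ecut, xl.cutoff_PfC ζ.contDiff hhs]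
  -- the three pieces are smooth
  have p1 : ContDiff ℝ ∞ (xl.PfC (mulC ζ h)) := xl.contDiff_PfC (contDiff_mulC ζ.contDiff hhs)
  have p2j : ∀ j, ContDiff ℝ ∞ (xl.D j (mulC (xl.Xap j ζ) h)) := fun j =>
    xl.contDiff_D j (contDiff_mulC (xl.contDiff_Xap j ζ.contDiff) hhs)
  have p2 : ContDiff ℝ ∞ (fun x => ∑ j, xl.D j (mulC (xl.Xap j ζ) h) x) := ContDiff.sum fun j _ => p2j j
  have p3 : ContDiff ℝ ∞ (fun x => (xl.mcoef ζ x : ℂ) * h x) :=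
    (Complex.ofRealCLM.contDiff.comp (xl.contDiff_mcoef ζ.contDiff)).mul hhs
  -- linearity of `uC`
  have e1 : (fun x => xl.PfC (mulC ζ h) x - 2 * (∑ j, xl.D j (mulC (xl.Xap j ζ) h) x) +
      (xl.mcoef ζ x : ℂ) * h x) = fun x => (xl.PfC (mulC ζ h) x +
        (-2) * (∑ j, xl.D j (mulC (xl.Xap j ζ) h) x)) + (xl.mcoef ζ x : ℂ) * h x := by
    ext x; ring
  rw [e1, uC_add u ζ' (p1.add (contDiff_const.mul p2)) p3, uC_add u ζ' p1 (contDiff_const.mul p2),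
    uC_const_mul u ζ' (-2) p2]
  -- `uC` of the sum over `j` is the sum of the `uC`s
  have hsumC : ∀ (S : Finset (Fin J)), uC u ζ' (fun x => ∑ j ∈ S, xl.D j (mulC (xl.Xap j ζ) h) x) =
      ∑ j ∈ S, uC u ζ' (xl.D j (mulC (xl.Xap j ζ) h)) := by
    intro S
    classical
    induction S using Finset.induction_on with
    | empty =>
      simp only [Finset.sum_empty]
      have := uC_const_mul u ζ' 0 (h := fun _ : E => (0 : ℂ)) contDiff_const
      simpa using this
    | insert a S ha ih =>
      simp only [Finset.sum_insert ha]
      rw [uC_add u ζ' (p2j a) (ContDiff.sum fun j _ => p2j j), ih]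
  rw [hsumC Finset.univ]
  -- the right side: pairings of the two Fourier-side functions
  have hψ := SchwartzMap.nice ψ
  obtain ⟨t', ht'⟩ := hG'.inH
  have iXj : ∀ j, InH (t' - 1) (kerOp (convKer (thetaOf (bη j))) (fd.Xf j G')) := fun j => by
    have := (rapidDecay_thetaOf (bη j)).kerDecay_convKer.inH_kerOp ((fd.X j).inH_applyF FlatHData.bas ht')
    rwa [sub_zero] at this
  have iS : InH (t' - 1) (fun ξ => ∑ j, kerOp (convKer (thetaOf (bη j))) (fd.Xf j G') ξ) :=
    InH.finset_sum _ iXj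
  have iM : InH t' (kerOp (convKer (thetaOf bm)) G') := by
    have := (rapidDecay_thetaOf bm).kerDecay_convKer.inH_kerOp ht'; rwa [sub_zero] at this
  have iS' := iS.const_mul (-2)
  have iM' := iM.mono (show t' - 1 ≤ t' by linarith)
  rw [pairing_add_left iS' iM' (hψ.inH _), pairing_const_mul_left (-2 : ℂ)]
  -- identify the two pairings
  have q2 : pairing (fun ξ => ∑ j, kerOp (convKer (thetaOf (bη j))) (fd.Xf j G') ξ) ψ =
      ∑ j, uC u ζ' (xl.D j (mulC (xl.Xap j ζ) h)) := by
    have hrep : ∀ j, Rep u ζ' (T : E →L[ℝ] V) (kerOp (convKer (thetaOf (bη j))) (fd.Xf j G'))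
        (fun g => xl.D j (mulC (xl.Xap j ζ) g)) := fun j =>
      (hG'.flatField (xl.xX j)).conv (xl.contDiff_Xap j ζ.contDiff) (b := bη j) (hbη j)
    have hsum := Rep.finset_sum Finset.univ hrep
    rw [hsum.eq ψ]
    exact hsumC Finset.univ
  have q3 : pairing (kerOp (convKer (thetaOf bm)) G') ψ = uC u ζ' (fun x => (xl.mcoef ζ x : ℂ) * h x) := by
    have hrep : Rep u ζ' (T : E →L[ℝ] V) (kerOp (convKer (thetaOf bm)) G') (fun g => mulC (xl.mcoef ζ) g) :=
      hG'.conv (xl.contDiff_mcoef ζ.contDiff) (b := bm) hbm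
    exact hrep.eq ψ
  rw [q2, q3]
  ring

/-- **The key identity with a coupling term, a.e. form**: if `uC u ζ' (PfC (ζ g)) = ∫ Fζ g dμ + Λ g`
for smooth `g` (the equation `P u = F + Λ` near `tsupport ζ`, tested), the extra functional being
represented on the Fourier side, `Λ (conj ∘ 𝓕ψ ∘ T) = pairing H ψ` with `H` in some `Ĥ^{s₀}`, then
`Pf G =ᵐ c_T 𝓕⁻¹q + (-2 ∑_j conv_{η_j} (Xf_j G') + conv_m G') + H`. [folklore] -/
theorem Pf_ae_eq_add {G G' : V → ℂ} (hG : Rep u ζ (T : E →L[ℝ] V) G id)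
    (hG' : Rep u ζ' (T : E →L[ℝ] V) G' id) (hζ : ∀ x, ζ' x * ζ x = ζ x)
    (bη : Fin J → 𝓢(V, ℂ)) (hbη : ∀ j x, (xl.Xap j ζ x : ℂ) = bη j (T x))
    (bm : 𝓢(V, ℂ)) (hbm : ∀ x, (xl.mcoef ζ x : ℂ) = bm (T x))
    [MeasurableSpace E] {μ : Measure E} {Fζ : E → ℂ} {Λ : (E → ℂ) → ℂ} {H : V → ℂ} {s₀ : ℝ}
    (hH : InH s₀ H)
    (hPu : ∀ g : E → ℂ, ContDiff ℝ ∞ g →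
      uC u ζ' (xl.PfC (mulC ζ g)) = (∫ x, Fζ x * g x ∂μ) + Λ g)
    (hΛ : ∀ ψ : 𝓢(V, ℂ), Λ (fun x => conj (𝓕 ψ ((T : E →L[ℝ] V) x))) = pairing H ψ)
    {q : 𝓢(V, ℂ)} (hq : ∀ x, Fζ x = q (T x)) {cT : ℂ}
    (hT : ∀ g : V → ℂ, ∫ x, g (T x) ∂μ = cT * ∫ y, g y) :
    fd.Pf G =ᵐ[volume] fun ξ => (cT * 𝓕⁻ (q : V → ℂ) ξ +
        ((-2) * (∑ j, kerOp (convKer (thetaOf (bη j))) (fd.Xf j G') ξ) +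
          kerOp (convKer (thetaOf bm)) G' ξ)) + H ξ := by
  obtain ⟨t, ht⟩ := (hG.Pf xl).inH
  obtain ⟨t', ht'⟩ := hG'.inH
  have iN : InH 0 (fun ξ => cT * 𝓕⁻ (q : V → ℂ) ξ) := (nice_const_mul_fourierInv cT q).inH 0
  have iXj : ∀ j, InH (t' - 1) (kerOp (convKer (thetaOf (bη j))) (fd.Xf j G')) := fun j => by
    have := (rapidDecay_thetaOf (bη j)).kerDecay_convKer.inH_kerOp ((fd.X j).inH_applyF FlatHData.bas ht')
    rwa [sub_zero] at this
  have iS : InH (t' - 1) (fun ξ => ∑ j, kerOp (convKer (thetaOf (bη j))) (fd.Xf j G') ξ) := InH.finset_sum _ iXj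
  have iM : InH t' (kerOp (convKer (thetaOf bm)) G') := by
    have := (rapidDecay_thetaOf bm).kerDecay_convKer.inH_kerOp ht'; rwa [sub_zero] at this
  set s : ℝ := min (min 0 (t' - 1)) s₀ with hs
  have hs1 : s ≤ 0 := (min_le_left _ _).trans (min_le_left _ _)
  have hs2 : s ≤ t' - 1 := (min_le_left _ _).trans (min_le_right _ _)
  have hs3 : s ≤ s₀ := min_le_right _ _
  have iN' := iN.mono hs1
  have iB : InH (t' - 1) (fun ξ => (-2) * (∑ j, kerOp (convKer (thetaOf (bη j))) (fd.Xf j G') ξ) +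
      kerOp (convKer (thetaOf bm)) G' ξ) := (iS.const_mul (-2)).add (iM.mono (by linarith))
  have iB' := iB.mono hs2
  have iH' := hH.mono hs3
  have iR : InH s (fun ξ => (cT * 𝓕⁻ (q : V → ℂ) ξ +
      ((-2) * (∑ j, kerOp (convKer (thetaOf (bη j))) (fd.Xf j G') ξ) +
        kerOp (convKer (thetaOf bm)) G' ξ)) + H ξ) := (iN'.add iB').add iH'
  have hT' : ∀ g : V → ℂ, ∫ x, g ((T : E →L[ℝ] V) x) ∂μ = cT * ∫ y, g y := hT
  have hq' : ∀ x, Fζ x = q ((T : E →L[ℝ] V) x) := hq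
  refine ae_eq_of_forall_pairing_schwartz ht iR fun ψ => ?_
  have hψ := SchwartzMap.nice ψ
  rw [xl.pairing_Pf_eq_uC_add hG hG' hζ bη hbη bm hbm ψ, hPu _ (contDiff_conj_fourier_comp _ ψ), hΛ ψ,
    (integral_density_eq_pairing μ hT' hq' ψ), pairing_add_left (iN'.add iB') iH' (hψ.inH _),
    pairing_add_left iN' iB' (hψ.inH _)]
  ring

/-- **Corollary**: under the hypotheses of the coupled key identity, if `G', Xf_j G', H ∈ Ĥ^t` then
`Pf G ∈ Ĥ^t`. [folklore] -/
theorem inH_Pf_of_cutoff_add {G G' : V → ℂ} (hG : Rep u ζ (T : E →L[ℝ] V) G id)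
    (hG' : Rep u ζ' (T : E →L[ℝ] V) G' id) (hζ : ∀ x, ζ' x * ζ x = ζ x)
    (bη : Fin J → 𝓢(V, ℂ)) (hbη : ∀ j x, (xl.Xap j ζ x : ℂ) = bη j (T x))
    (bm : 𝓢(V, ℂ)) (hbm : ∀ x, (xl.mcoef ζ x : ℂ) = bm (T x))
    [MeasurableSpace E] {μ : Measure E} {Fζ : E → ℂ} {Λ : (E → ℂ) → ℂ} {H : V → ℂ}
    (hPu : ∀ g : E → ℂ, ContDiff ℝ ∞ g →
      uC u ζ' (xl.PfC (mulC ζ g)) = (∫ x, Fζ x * g x ∂μ) + Λ g)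
    (hΛ : ∀ ψ : 𝓢(V, ℂ), Λ (fun x => conj (𝓕 ψ ((T : E →L[ℝ] V) x))) = pairing H ψ)
    {q : 𝓢(V, ℂ)} (hq : ∀ x, Fζ x = q (T x)) {cT : ℂ}
    (hT : ∀ g : V → ℂ, ∫ x, g (T x) ∂μ = cT * ∫ y, g y)
    {t : ℝ} (htG' : InH t G') (htX : ∀ j, InH t (fd.Xf j G')) (htH : InH t H) :
    InH t (fd.Pf G) := by
  have hae := xl.Pf_ae_eq_add hG hG' hζ bη hbη bm hbm htH hPu hΛ hq hT
  have iN : InH t (fun ξ => cT * 𝓕⁻ (q : V → ℂ) ξ) := (nice_const_mul_fourierInv cT q).inH t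
  have iXj : ∀ j, InH t (kerOp (convKer (thetaOf (bη j))) (fd.Xf j G')) := fun j => by
    have := (rapidDecay_thetaOf (bη j)).kerDecay_convKer.inH_kerOp (htX j); rwa [sub_zero] at this
  have iS : InH t (fun ξ => ∑ j, kerOp (convKer (thetaOf (bη j))) (fd.Xf j G') ξ) := InH.finset_sum _ iXj
  have iM : InH t (kerOp (convKer (thetaOf bm)) G') := by
    have := (rapidDecay_thetaOf bm).kerDecay_convKer.inH_kerOp htG'; rwa [sub_zero] at this
  have iR : InH t (fun ξ => (cT * 𝓕⁻ (q : V → ℂ) ξ +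
      ((-2) * (∑ j, kerOp (convKer (thetaOf (bη j))) (fd.Xf j G') ξ) +
        kerOp (convKer (thetaOf bm)) G' ξ)) + H ξ) :=
    (iN.add ((iS.const_mul (-2)).add iM)).add htH
  obtain ⟨s, hs⟩ := (hG.Pf xl).inH
  exact ⟨hs.1, by rw [wnorm_congr_ae hae]; exact iR.2⟩

end FlatHData.XLink

/-! ### The complexified localized action is linear in the distribution -/

section LinearInU

variable {Ω : Opens E}

/-- `uC (u + v) ζ h = uC u ζ h + uC v ζ h`. [folklore] -/
theorem uC_add_distrib (u v : 𝓓'(Ω, ℝ)) (ζ : 𝓓(Ω, ℝ)) {h : E → ℂ} (hh : ContDiff ℝ ∞ h) :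
    uC (u + v) ζ h = uC u ζ h + uC v ζ h := by
  rw [uC_eq _ ζ hh, uC_eq u ζ hh, uC_eq v ζ hh]
  simp only [add_apply]
  push_cast
  ring

/-- `uC (c • u) ζ h = c * uC u ζ h`. [folklore] -/
theorem uC_smul_distrib (c : ℝ) (u : 𝓓'(Ω, ℝ)) (ζ : 𝓓(Ω, ℝ)) {h : E → ℂ} (hh : ContDiff ℝ ∞ h) :
    uC (c • u) ζ h = (c : ℂ) * uC u ζ h := by
  rw [uC_eq _ ζ hh, uC_eq u ζ hh]
  simp only [smul_apply, smul_eq_mul]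
  push_cast
  ring

/-- `uC (∑ c_i • u_i) ζ h = ∑ c_i uC u_i ζ h`. [folklore] -/
theorem uC_sum_smul_distrib {W : Type*} (s : Finset W) (c : W → ℝ) (u : W → 𝓓'(Ω, ℝ)) (ζ : 𝓓(Ω, ℝ))
    {h : E → ℂ} (hh : ContDiff ℝ ∞ h) :
    uC (∑ w ∈ s, c w • u w) ζ h = ∑ w ∈ s, (c w : ℂ) * uC (u w) ζ h := by
  classical
  induction s using Finset.induction_on with
  | empty =>
    simp only [Finset.sum_empty]
    rw [uC_eq _ ζ hh]
    simp
  | insert a s ha ih =>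
    rw [Finset.sum_insert ha, Finset.sum_insert ha, uC_add_distrib _ _ ζ hh, uC_smul_distrib _ _ ζ hh, ih]

end LinearInU

/-! ### The hypothesis of the coupled key identity -/

namespace Chart

variable {K : ℕ} (C : Chart V K) (T : E ≃L[ℝ] V)
variable {ι : Type*} [Fintype ι] {X₀ : E → E} {X : ι → E → E} {c : E → ℝ}
variable {Ω : Opens E}

/-- **The hypothesis `hPu` of the coupled key identity** from the coupled equation
`u (ᵗPφ) = ∫ f φ dμ + v φ` (`φ` supported in `U`): for a cutoff `ζ` supported in `U` and in the
chart ball `T⁻¹(ball y₀ δ)` and `ζ' = 1` on `tsupport ζ`,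
`uC u ζ' (PfC (ζ g)) = ∫ f ζ g dμ + uC v ζ g`. [folklore] -/
theorem hPu_add [FiniteDimensional ℝ E] [MeasurableSpace E] [BorelSpace E] (μ : Measure E)
    [IsLocallyFiniteMeasure μ]
    (eK : ι ≃ Fin K) (hXV : ∀ i, C.XV i = push T (X (eK.symm i)))
    (hXV0 : C.XV0 = push T X₀) (hcV : C.cV = fun y => c (T.symm y))
    (hX₀ : ContDiff ℝ ∞ X₀) (hX : ∀ j, ContDiff ℝ ∞ (X j)) (hc : ContDiff ℝ ∞ c)
    {u v : 𝓓'(Ω, ℝ)} {U : Set E} (hU : IsOpen U) {f : E → ℝ} (hfU : ContinuousOn f U)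
    (hfu : ∀ φ ψ : 𝓓(Ω, ℝ), tsupport (φ : E → ℝ) ⊆ U → (ψ : E → ℝ) = hormanderTranspose X₀ X c φ →
      u ψ = (∫ x, f x * φ x ∂μ) + v φ)
    {ζ ζ' : 𝓓(Ω, ℝ)} (hζU : tsupport (ζ : E → ℝ) ⊆ U)
    (hζB : tsupport (ζ : E → ℝ) ⊆ T ⁻¹' ball C.y₀ C.δ)
    (hζ' : ∀ x ∈ tsupport (ζ : E → ℝ), ζ' x = 1)
    {g : E → ℂ} (hg : ContDiff ℝ ∞ g) :
    uC u ζ' ((C.xl T).PfC (mulC ζ g)) = (∫ x, ((f x * ζ x : ℝ) : ℂ) * g x ∂μ) + uC v ζ g := by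
  rw [uC_eq v ζ hg]
  -- split `g` into real and imaginary parts
  have hgr_s : ContDiff ℝ ∞ (fun x => (g x).re) := Complex.reCLM.contDiff.comp hg
  have hgi_s : ContDiff ℝ ∞ (fun x => (g x).im) := Complex.imCLM.contDiff.comp hg
  set φr : 𝓓(Ω, ℝ) := mulSmooth ζ (fun x => (g x).re) (Complex.reCLM.contDiff.comp hg) with hφr
  set φi : 𝓓(Ω, ℝ) := mulSmooth ζ (fun x => (g x).im) (Complex.imCLM.contDiff.comp hg) with hφi
  have esplit : mulC ζ g = fun x => (φr x : ℂ) + Complex.I * (φi x : ℂ) := by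
    ext x
    simp only [mulC, hφr, hφi, mulSmooth_apply]
    push_cast
    linear_combination ((ζ x : ℝ) : ℂ) * (Complex.re_add_im (g x)).symm
  have hφr_s : ContDiff ℝ ∞ (fun x => (φr x : ℂ)) := Complex.ofRealCLM.contDiff.comp φr.contDiff
  have hφi_s : ContDiff ℝ ∞ (fun x => (φi x : ℂ)) := Complex.ofRealCLM.contDiff.comp φi.contDiff
  rw [esplit, C.PfC_add T hφr_s (contDiff_const.mul hφi_s), C.PfC_const_mul T Complex.I hφi_s,
    uC_add u ζ' ((C.xl T).contDiff_PfC hφr_s) (contDiff_const.mul ((C.xl T).contDiff_PfC hφi_s)),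
    uC_const_mul u ζ' Complex.I ((C.xl T).contDiff_PfC hφi_s)]
  -- each real piece: `uC u ζ' (PfC φ) = ∫ f φ + v φ`
  have hpiece : ∀ φ : 𝓓(Ω, ℝ), tsupport (φ : E → ℝ) ⊆ tsupport (ζ : E → ℝ) →
      uC u ζ' ((C.xl T).PfC fun x => (φ x : ℂ)) = ((∫ x, f x * φ x ∂μ : ℝ) : ℂ) + ((v φ : ℝ) : ℂ) := by
    intro φ hφζ
    have hsupp : tsupport (φ : E → ℝ) ⊆ T ⁻¹' ball C.y₀ C.δ := hφζ.trans hζB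
    have ePf : ((C.xl T).PfC fun x => (φ x : ℂ)) = fun x => ((hormanderTranspose X₀ X c φ x : ℝ) : ℂ) :=
      funext fun x => C.PfC_ofReal T eK hXV hXV0 hcV hX₀ hX φ.contDiff hsupp x
    rw [ePf, uC_ofReal u ζ' (contDiff_hormanderTranspose hX₀ hX hc φ.contDiff)]
    -- `ζ' ᵗPφ = ᵗPφ`
    have emul : mulSmooth ζ' (hormanderTranspose X₀ X c φ) (contDiff_hormanderTranspose hX₀ hX hc φ.contDiff) =
        hormanderTransposeTestFunction hX₀ hX hc φ := by
      ext x
      rw [mulSmooth_apply, coe_hormanderTransposeTestFunction]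
      by_cases hx : x ∈ tsupport (hormanderTranspose X₀ X c φ)
      · rw [hζ' x (hφζ (tsupport_hormanderTranspose_subset X₀ X c φ hx)), one_mul]
      · rw [image_eq_zero_of_notMem_tsupport hx, mul_zero]
    rw [emul, hfu φ _ (hφζ.trans hζU) (coe_hormanderTransposeTestFunction hX₀ hX hc φ)]
    push_cast
    rfl
  have hsr : tsupport (φr : E → ℝ) ⊆ tsupport (ζ : E → ℝ) := tsupport_mul_subset_left
  have hsi : tsupport (φi : E → ℝ) ⊆ tsupport (ζ : E → ℝ) := tsupport_mul_subset_left
  rw [hpiece φr hsr, hpiece φi hsi]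
  -- reassemble the integral
  have hfr : Integrable (fun x => f x * φr x) μ :=
    integrable_mul_of_tsupport_subset hU hfU φr.contDiff.continuous φr.hasCompactSupport (hsr.trans hζU)
  have hfi : Integrable (fun x => f x * φi x) μ :=
    integrable_mul_of_tsupport_subset hU hfU φi.contDiff.continuous φi.hasCompactSupport (hsi.trans hζU)
  have e3 : (fun x => ((f x * ζ x : ℝ) : ℂ) * g x) =
      fun x => ((f x * φr x : ℝ) : ℂ) + Complex.I * ((f x * φi x : ℝ) : ℂ) := by
    ext x
    simp only [hφr, hφi, mulSmooth_apply]
    push_cast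
    linear_combination ((f x : ℂ) * (ζ x : ℂ)) * (Complex.re_add_im (g x)).symm
  rw [e3, integral_add hfr.ofReal (hfi.ofReal.const_mul _), integral_const_mul,
    show (∫ a, ((f a * φr a : ℝ) : ℂ) ∂μ) = ((∫ a, f a * φr a ∂μ : ℝ) : ℂ) from integral_ofReal,
    show (∫ a, ((f a * φi a : ℝ) : ℂ) ∂μ) = ((∫ a, f a * φi a ∂μ : ℝ) : ℂ) from integral_ofReal]
  ring

end Chart

/-! ### Charts at a point -/

section Charts

variable [FiniteDimensional ℝ E]
variable {ι : Type*} [Fintype ι] {X₀ : E → E} {X : ι → E → E} {c : E → ℝ}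

omit [MeasurableSpace V] [BorelSpace V] in
/-- **Around every point of `Ω` there is a chart of `P`** (positive dimension): a chart
`C : Chart V (card ι)` centred at `T x₀` whose fields and coefficient are the pushforwards of
`(X₀, X, c)` along `T` (reindexed by `Fintype.equivFin ι`), together with spanning data `S`
(the data assembled inside `HormanderProof.exists_chart_nhds`). [folklore] -/
theorem exists_chartAt (hX₀ : ContDiff ℝ ∞ X₀) (hX : ∀ j, ContDiff ℝ ∞ (X j)) (hc : ContDiff ℝ ∞ c)
    {Ω : Opens E} (hgen : IsBracketGenerating (fun o : Option ι => o.elim X₀ X) (Ω : Set E))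
    (T : E ≃L[ℝ] V) (hpos : finrank ℝ V ≠ 0) {x₀ : E} (hx₀ : x₀ ∈ Ω) :
    ∃ (m : ℕ) (C : Chart V (Fintype.card ι)) (_ : C.SpanIn m),
      (∀ i, C.XV i = push T (X ((Fintype.equivFin ι).symm i))) ∧ C.XV0 = push T X₀ ∧
      (C.cV = fun y => c (T.symm y)) ∧ C.y₀ = T x₀ := by
  -- indices
  set K : ℕ := Fintype.card ι with hK
  set eK : ι ≃ Fin K := Fintype.equivFin ι with heK
  set n : ℕ := finrank ℝ V with hn
  -- the `E`-side fields indexed by `Fin (K + n)` (zero beyond `K`)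
  set XJ : Fin (K + n) → E → E := Fin.append (fun i => X (eK.symm i)) (fun _ _ => 0) with hXJ
  have hXJs : ∀ j, ContDiff ℝ ∞ (XJ j) := by
    intro j
    refine Fin.addCases (fun i => ?_) (fun l => ?_) j
    · simp only [hXJ, Fin.append_left]; exact hX _
    · simp only [hXJ, Fin.append_right]; exact contDiff_const
  set emb : ι → Fin (K + n) := fun i => Fin.castAdd n (eK i) with hemb
  have hembX : ∀ i, XJ (emb i) = X i := fun i => by simp [hXJ, hemb]
  -- spanning words at `x₀`
  obtain ⟨m, w, hwidx, hspan⟩ := exists_spanning_words (X₀ := X₀) (XJ := XJ) emb hembX hx₀ hgen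
  have hlow : ∀ i, LowIdx (w i) := fun i =>
    (hwidx i).mono (fun j hj => by obtain ⟨i', rfl⟩ := hj; simp [hemb]) (w i)
  -- the `V`-side fields and the word brackets without cutoffs
  set XVf : Fin K → V → V := fun i => push T (X (eK.symm i)) with hXVf
  set XV0 : V → V := push T X₀ with hXV0
  have hXVs : ∀ i, ContDiff ℝ ∞ (XVf i) := fun i => contDiff_push T (hX _)
  have hXV0s : ContDiff ℝ ∞ XV0 := contDiff_push T hX₀
  set XBz : Fin (K + n) → V → V := Fin.append XVf (fun _ _ => 0) with hXBz
  have hXBzs : ∀ j, ContDiff ℝ ∞ (XBz j) := by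
    intro j
    refine Fin.addCases (fun i => ?_) (fun l => ?_) j
    · simp only [hXBz, Fin.append_left]; exact hXVs _
    · simp only [hXBz, Fin.append_right]; exact contDiff_const
  set Zf : Fin m → V → V := fun i => vbr XBz XV0 (w i) with hZf
  have hZs : ∀ i, ContDiff ℝ ∞ (Zf i) := fun i => contDiff_vbr hXBzs hXV0s (w i)
  have hpush : (fun j => push T (XJ j)) = XBz := by
    funext j
    refine Fin.addCases (fun i => ?_) (fun l => ?_) j
    · simp [hXJ, hXBz, hXVf]
    · ext y; simp [hXJ, hXBz, push]
  have hZy₀ : ∀ i, Zf i (T x₀) = T (ebr X₀ XJ (w i) x₀) := by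
    intro i
    have : Zf i = push T (ebr X₀ XJ (w i)) := by
      rw [push_ebr T hX₀ hXJs (w i), hpush]
    rw [this, push_apply]
  have hspanV : Submodule.span ℝ (Set.range fun i => Zf i (T x₀)) = ⊤ := by
    have e : (Set.range fun i => Zf i (T x₀)) =
        ((T : E →ₗ[ℝ] V) : E → V) '' Set.range (fun i => ebr X₀ XJ (w i) x₀) := by
      ext v
      simp only [Set.mem_range, Set.mem_image, hZy₀]
      constructor
      · rintro ⟨i, rfl⟩; exact ⟨_, ⟨i, rfl⟩, rfl⟩
      · rintro ⟨_, ⟨i, rfl⟩, rfl⟩; exact ⟨i, rfl⟩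
    rw [e, Submodule.span_image, hspan, Submodule.map_top, LinearMap.range_eq_top]
    exact T.surjective
  -- Gram coefficients
  obtain ⟨δ₀, hδ₀, gcoef, hgs, hgsum⟩ := exists_gram hZs hspanV (FlatHData.bas (V := V))
  -- the radius
  set δ : ℝ := δ₀ / 3 with hδdef
  have hδ : 0 < δ := by rw [hδdef]; positivity
  have h2 : 2 * δ < δ₀ := by rw [hδdef]; linarith
  -- the chart and its spanning data
  let C : Chart V K :=
    { XV := XVf, XV0 := XV0, cV := fun y => c (T.symm y), hXV := hXVs, hXV0 := hXV0s,
      hcV := hc.comp T.symm.contDiff, y₀ := T x₀, δ := δ, hδ := hδ, pos := hpos }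
  let S : C.SpanIn m :=
    { w := w, low := hlow, δ₀ := δ₀, gcoef := gcoef, hsmooth := hgs, hsum := hgsum, hδ₀ := h2 }
  exact ⟨m, C, S, fun _ => rfl, rfl, rfl, rfl⟩

end Charts


/-! ### Coupled systems: smoothness near a point covered by charts -/

section System

variable [FiniteDimensional ℝ E] [MeasurableSpace E] [BorelSpace E] (μ : Measure E) [μ.IsAddHaarMeasure]
variable {ι : Type*} [Fintype ι] {W : Type*} [Fintype W]
variable {X₀ : W → E → E} {X : W → ι → E → E} {c : W → E → ℝ}

omit [Fintype W] in
/-- Finite sums on the left of `pairing`. [folklore] -/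
theorem pairing_sum_left {s : ℝ} (S : Finset W) {F : W → V → ℂ} (hF : ∀ w, InH s (F w)) {G : V → ℂ}
    (hG : InH (-s) G) : pairing (fun ξ => ∑ w ∈ S, F w ξ) G = ∑ w ∈ S, pairing (F w) G := by
  classical
  induction S using Finset.induction_on with
  | empty => simp [pairing]
  | insert a S ha ih =>
    simp only [Finset.sum_insert ha]
    rw [pairing_add_left (hF a) (InH.finset_sum S (fun w => hF w)) hG, ih]

omit [FiniteDimensional ℝ E] [MeasurableSpace E] [BorelSpace E] [Fintype W] in
/-- Evaluation of a finite linear combination of distributions. [folklore] -/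
theorem distribution_sum_smul_apply {Ω : Opens E} (s : Finset W) (a : W → ℝ) (u : W → 𝓓'(Ω, ℝ))
    (φ : 𝓓(Ω, ℝ)) : (∑ w ∈ s, a w • u w) φ = ∑ w ∈ s, a w * u w φ := by
  classical
  induction s using Finset.induction_on with
  | empty => simp
  | insert b s hb ih => rw [Finset.sum_insert hb, Finset.sum_insert hb, add_apply, smul_apply, ih, smul_eq_mul]

/-- **Smoothness of the solutions of a coupled system near a point covered by charts** (Kohn's
bootstrap run jointly over the components). Data: for every `w : W` a Hörmander operator
`P_w = ∑_j (X^w_j)² + X^w₀ + c_w` with a chart `C w` of `P_w` (for the same `T : E ≃L V`), a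
coupling matrix `a`, distributions `u_w ∈ 𝓓'(Ω)` and functions `f_w` smooth on the open `U ⊆ Ω`
solving the square system `P_w u_w = f_w + ∑_{w'} a_{w w'} u_{w'}` on `U`
(`u_w (ᵗP_w φ) = ∫ f_w φ dμ + ∑_{w'} a_{w w'} u_{w'}(φ)` for `φ` supported in `U`). If
`closedBall x 3ρ ⊆ U` lies in every chart ball `T⁻¹(ball y₀^w δ^w)`, then every `u_w` is a smooth
function on `ball x ρ`. Proof: the bootstrap `G^w_ζ ∈ Ĥ^t ⇒ G^w_ζ ∈ Ĥ^{t+ε/2}` of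
`HormanderProof.isHypoellipticOn_chart` for ALL `w` and all cutoffs `ζ` supported in `ball x 2ρ`
simultaneously, with the common gain `ε = min_w ε_w`; the coupling `∑_{w'} a_{w w'} ζ u_{w'}` enters
the key identity (`inH_Pf_of_cutoff_add`) through its Fourier side `∑_{w'} a_{w w'} G^{w'}_ζ ∈ Ĥ^t`,
which IS the induction hypothesis of the other components. [folklore] -/
theorem isSmoothOn_ball_coupled (hX₀ : ∀ w, ContDiff ℝ ∞ (X₀ w)) (hX : ∀ w j, ContDiff ℝ ∞ (X w j))
    (hc : ∀ w, ContDiff ℝ ∞ (c w))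
    (T : E ≃L[ℝ] V) {K : ℕ} (C : W → Chart V K) {m : W → ℕ} (S : ∀ w, (C w).SpanIn (m w)) (eK : ι ≃ Fin K)
    (hXV : ∀ w i, (C w).XV i = push T (X w (eK.symm i))) (hXV0 : ∀ w, (C w).XV0 = push T (X₀ w))
    (hcV : ∀ w, (C w).cV = fun y => c w (T.symm y))
    {Ω : Opens E} (a : W → W → ℝ) (u : W → 𝓓'(Ω, ℝ)) {U : Set E} (hU : IsOpen U) (hUΩ : U ⊆ Ω)
    {f : W → E → ℝ} (hfU : ∀ w, ContDiffOn ℝ ∞ (f w) U)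
    (hfu : ∀ w (φ ψ : 𝓓(Ω, ℝ)), tsupport (φ : E → ℝ) ⊆ U →
      (ψ : E → ℝ) = hormanderTranspose (X₀ w) (X w) (c w) φ →
      u w ψ = (∫ x, f w x * φ x ∂μ) + ∑ w', a w w' * u w' φ)
    {x : E} {ρ : ℝ} (hρ0 : 0 < ρ) (h3ρ : closedBall x (3 * ρ) ⊆ U)
    (hball : ∀ w, closedBall x (3 * ρ) ⊆ T ⁻¹' ball (C w).y₀ (C w).δ) (w₀ : W) :
    IsSmoothOn (u w₀) μ (ball x ρ) := by
  -- Fourier-side data of the charts and a common gain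
  have hP : ∀ w G, (C w).g.d.opP.apply G = (C w).g.fd.Pf G := fun w => (C w).g.apply_opP
  have hXs : ∀ w j G, ((C w).g.d.Xs j).apply G = (C w).g.fd.Xf j G := fun w => (C w).g.apply_Xs
  have hεw0 : ∀ w, 0 < (C w).g.d.epsOf (fun k => ((C w).spanData (S w) k).L) := fun w =>
    (C w).g.d.epsOf_pos _
  obtain ⟨wm, -, hwm⟩ := Finset.exists_min_image Finset.univ
    (fun w => (C w).g.d.epsOf (fun k => ((C w).spanData (S w) k).L)) ⟨w₀, Finset.mem_univ _⟩
  set ε : ℝ := (C wm).g.d.epsOf (fun k => ((C wm).spanData (S wm) k).L) with hε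
  have hε0 : 0 < ε := hεw0 wm
  have hεle : ∀ w, ε ≤ (C w).g.d.epsOf (fun k => ((C w).spanData (S w) k).L) := fun w =>
    hwm w (Finset.mem_univ _)
  -- change of variables
  obtain ⟨cT, hcT, hT⟩ := exists_integral_comp_eq μ T
  have hT' : ∀ g : V → ℂ, ∫ x, g ((T : E →L[ℝ] V) x) ∂μ = (cT : ℂ) * ∫ y, g y := hT
  -- the balls
  have h2ρU : ball x (2 * ρ) ⊆ U :=
    (ball_subset_closedBall.trans (closedBall_subset_closedBall (by linarith))).trans h3ρ
  have hK2 : (closedBall x (2 * ρ) : Set E) ⊆ Ω :=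
    ((closedBall_subset_closedBall (by linarith)).trans h3ρ).trans hUΩ
  have hK2B : ∀ w, (closedBall x (2 * ρ) : Set E) ⊆ T ⁻¹' ball (C w).y₀ (C w).δ := fun w =>
    (closedBall_subset_closedBall (by linarith)).trans (hball w)
  -- uniform Fourier sides for cutoffs supported in `closedBall x 2ρ`, one `M` for all `w`
  have hMw : ∀ w, ∃ M : ℝ, ∀ ζ : 𝓓(Ω, ℝ), tsupport (ζ : E → ℝ) ⊆ closedBall x (2 * ρ) →
      ∃ G : V → ℂ, InH (-M) G ∧ ∀ ψ : 𝓢(V, ℂ), pairing G ψ = fourierFun (u w) ζ (T : E →L[ℝ] V) ψ :=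
    fun w => exists_fourierSide_unif (u w) ⟨closedBall x (2 * ρ), isCompact_closedBall x _⟩ hK2 (T : E →L[ℝ] V)
  choose Mw hMw using hMw
  set M : ℝ := ∑ w, |Mw w| with hM
  have hMle : ∀ w, Mw w ≤ M := fun w => (le_abs_self _).trans
    (Finset.single_le_sum (f := fun w => |Mw w|) (fun _ _ => abs_nonneg _) (Finset.mem_univ w))
  have hM' : ∀ w (ζ : 𝓓(Ω, ℝ)), tsupport (ζ : E → ℝ) ⊆ closedBall x (2 * ρ) →
      ∃ G : V → ℂ, InH (-M) G ∧ ∀ ψ : 𝓢(V, ℂ), pairing G ψ = fourierFun (u w) ζ (T : E →L[ℝ] V) ψ := by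
    intro w ζ hζ
    obtain ⟨G, hG, hGp⟩ := hMw w ζ hζ
    exact ⟨G, hG.mono (by linarith [hMle w]), hGp⟩
  choose G hGin hGpair using hM'
  -- `G w ζ _` represents the identity
  have hRep : ∀ w (ζ : 𝓓(Ω, ℝ)) (hζ : tsupport (ζ : E → ℝ) ⊆ closedBall x (2 * ρ)),
      Rep (u w) ζ (T : E →L[ℝ] V) (G w ζ hζ) id := fun w ζ hζ =>
    ⟨⟨-M, hGin w ζ hζ⟩, fun h hh => hh, fun _ _ _ _ => rfl, fun _ _ _ => rfl, fun ψ => by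
      rw [hGpair w ζ hζ ψ, fourierFun_eq_uC]; rfl⟩
  have hbs : ∀ {ζ : 𝓓(Ω, ℝ)}, tsupport (ζ : E → ℝ) ⊆ ball x (2 * ρ) →
      tsupport (ζ : E → ℝ) ⊆ closedBall x (2 * ρ) := fun hζ => hζ.trans ball_subset_closedBall
  -- the coupling as one distribution per component
  set v : W → 𝓓'(Ω, ℝ) := fun w => ∑ w', a w w' • u w' with hv
  have hfu' : ∀ w (φ ψ : 𝓓(Ω, ℝ)), tsupport (φ : E → ℝ) ⊆ U →
      (ψ : E → ℝ) = hormanderTranspose (X₀ w) (X w) (c w) φ →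
      u w ψ = (∫ x, f w x * φ x ∂μ) + v w φ := fun w φ ψ hφ hψ => by
    rw [hv]
    dsimp only
    rw [distribution_sum_smul_apply]
    exact hfu w φ ψ hφ hψ
  -- the joint bootstrap over `w` and over cutoffs supported in the OPEN ball `ball x 2ρ`
  have hlevel : ∀ N : ℕ, ∀ w (ζ : 𝓓(Ω, ℝ)) (hζ : tsupport (ζ : E → ℝ) ⊆ ball x (2 * ρ)),
      InH (-M - 1 + N * (ε / 2)) (G w ζ (hbs hζ)) ∧
        ∀ j, InH (-M - 1 + N * (ε / 2)) ((C w).g.fd.Xf j (G w ζ (hbs hζ))) := by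
    intro N
    induction N with
    | zero =>
      intro w ζ hζ
      simp only [Nat.cast_zero, zero_mul, add_zero]
      exact ⟨(hGin w ζ _).mono (by linarith), fun j => ((C w).g.fd.X j).inH_applyF FlatHData.bas (hGin w ζ _)⟩
    | succ N ih =>
      intro w ζ hζ
      set t : ℝ := -M - 1 + N * (ε / 2) with ht
      -- a cutoff `ζ' = 1` on `tsupport ζ`, supported in the ball
      obtain ⟨η, hηs, hηc, hηsupp, hη1⟩ := exists_bump ζ.hasCompactSupport isOpen_ball hζ
      let ζ' : 𝓓(Ω, ℝ) := ⟨η, hηs, hηc, hηsupp.trans ((ball_subset_closedBall).trans hK2)⟩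
      have hζ' : tsupport (ζ' : E → ℝ) ⊆ ball x (2 * ρ) := hηsupp
      have hζζ : ∀ z, ζ' z * ζ z = ζ z := fun z => by
        by_cases hz : z ∈ tsupport (ζ : E → ℝ)
        · rw [show (ζ' : E → ℝ) z = η z from rfl, hη1 z hz, one_mul]
        · rw [image_eq_zero_of_notMem_tsupport hz, mul_zero]
      obtain ⟨hG', hXG'⟩ := ih w ζ' hζ'
      have hGζ : ∀ w', InH t (G w' ζ (hbs hζ)) := fun w' => (ih w' ζ hζ).1
      obtain ⟨-, hXGζ⟩ := ih w ζ hζ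
      -- avatars (chart `w`)
      set xl := (C w).xl T with hxl
      have havη : ∀ j, ∃ b : 𝓢(V, ℂ), ∀ z, ((xl.Xap j ζ z : ℝ) : ℂ) = b (T z) := fun j =>
        (exists_avatar_real T (xl.contDiff_Xap j ζ.contDiff) (xl.hasCompactSupport_Xap j ζ.hasCompactSupport)).imp
          fun q hq => hq.1
      choose bη hbη using havη
      obtain ⟨bm, hbm, -⟩ := exists_avatar_real T (xl.contDiff_mcoef ζ.contDiff)
        (xl.hasCompactSupport_mcoef ζ.hasCompactSupport)
      have hfζs : ContDiff ℝ ∞ fun z => f w z * ζ z := by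
        have := contDiff_cutoff_mul' ζ.contDiff (U := U) (hζ.trans h2ρU)
          fun y hy => (hfU w).contDiffAt (hU.mem_nhds hy)
        simpa only [mul_comm] using this
      obtain ⟨q, hq, -⟩ := exists_avatar_real T hfζs (ζ.hasCompactSupport.mul_left)
      -- the coupled equation in the form of the coupled key identity
      have hPu' : ∀ g : E → ℂ, ContDiff ℝ ∞ g →
          uC (u w) ζ' (xl.PfC (mulC ζ g)) = (∫ z, ((f w z * ζ z : ℝ) : ℂ) * g z ∂μ) + uC (v w) ζ g :=
        fun g hg => (C w).hPu_add T μ eK (hXV w) (hXV0 w) (hcV w) (hX₀ w) (hX w) (hc w) hU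
          (hfU w).continuousOn (hfu' w) (hζ.trans h2ρU) ((hbs hζ).trans (hK2B w)) (fun z hz => hη1 z hz) hg
      -- the coupling term on the Fourier side: the induction hypothesis of the other components
      set H : V → ℂ := fun ξ => ∑ w', (a w w' : ℂ) * G w' ζ (hbs hζ) ξ with hH
      have htH : InH t H := InH.finset_sum _ fun w' => (hGζ w').const_mul _
      have hΛ : ∀ ψ : 𝓢(V, ℂ), uC (v w) ζ (fun z => conj (𝓕 ψ ((T : E →L[ℝ] V) z))) = pairing H ψ := by
        intro ψ
        have hψ := SchwartzMap.nice ψ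
        rw [hv]
        dsimp only
        rw [uC_sum_smul_distrib _ _ _ ζ (contDiff_conj_fourier_comp _ ψ), hH,
          pairing_sum_left Finset.univ (fun w' => (hGζ w').const_mul (a w w' : ℂ)) (hψ.inH _)]
        refine Finset.sum_congr rfl fun w' _ => ?_
        rw [pairing_const_mul_left, (hRep w' ζ (hbs hζ)).eq ψ]
        rfl
      -- the coupled key identity gives `Pf G_ζ ∈ Ĥ^t`
      have hPf : InH t ((C w).g.fd.Pf (G w ζ (hbs hζ))) :=
        xl.inH_Pf_of_cutoff_add (hRep w ζ _) (hRep w ζ' _) hζζ bη hbη bm hbm (μ := μ)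
          (Fζ := fun z => ((f w z * ζ z : ℝ) : ℂ)) (Λ := fun g => uC (v w) ζ g) (H := H)
          hPu' hΛ hq hT' hG' hXG' htH
      -- bootstrap in chart `w`, then lower the gain to the common `ε`
      have hb := HData.bootstrap_step (C w).g.d ((C w).spanHyp (S w)) (C w).g.fd (hP w) (hXs w) (hGζ w) hXGζ hPf
      have e1 : -M - 1 + ((N + 1 : ℕ) : ℝ) * (ε / 2) = t + ε / 2 := by push_cast; rw [ht]; ring
      rw [e1]
      have hle := hεle w
      exact ⟨hb.1.mono (by linarith), fun j => (hb.2 j).mono (by linarith)⟩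
  -- all `G w₀ ζ` are `Nice`
  have hNice : ∀ (ζ : 𝓓(Ω, ℝ)) (hζ : tsupport (ζ : E → ℝ) ⊆ ball x (2 * ρ)), Nice (G w₀ ζ (hbs hζ)) := by
    intro ζ hζ
    refine ⟨(hGin w₀ ζ _).1, fun t => ?_⟩
    obtain ⟨N, hN⟩ := exists_nat_gt ((t + M + 1) / (ε / 2))
    have hle : t ≤ -M - 1 + N * (ε / 2) := by
      have h2 : (t + M + 1) / (ε / 2) * (ε / 2) = t + M + 1 := div_mul_cancel₀ _ (by linarith)
      nlinarith [hN, h2, hε0]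
    exact ((hlevel N w₀ ζ hζ).1.mono hle).2
  -- the final cutoff, `= 1` on `ball x ρ`
  obtain ⟨η₁, hη₁s, hη₁c, hη₁supp, hη₁1⟩ := exists_bump (isCompact_closedBall x ρ) isOpen_ball
    (closedBall_subset_ball (by linarith : ρ < 2 * ρ))
  let ζ₁ : 𝓓(Ω, ℝ) := ⟨η₁, hη₁s, hη₁c, hη₁supp.trans ((ball_subset_closedBall).trans hK2)⟩
  have hζ₁ : tsupport (ζ₁ : E → ℝ) ⊆ ball x (2 * ρ) := hη₁supp
  haveI : SigmaFinite μ := by infer_instance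
  exact Rep.isSmoothOn (hRep w₀ ζ₁ (hbs hζ₁)) (hNice ζ₁ hζ₁) (Complex.ofReal_ne_zero.2 hcT) hT'
    (fun φ => (exists_avatar_real T φ.contDiff φ.hasCompactSupport).imp fun q hq => hq.1)
    (fun z hz => hη₁1 z (ball_subset_closedBall hz))

/-- **Hypoellipticity of square systems with diagonal Hörmander principal part and a constant
zeroth-order coupling** (Hörmander 1967, Thm 1.1 + Kohn's method, run jointly over the components;
cf. Helffer–Nier, LNM 1862, §2 for systems with scalar principal part). For every `w : W` let
`P_w = ∑_j (X^w_j)² + X^w₀ + c_w` have smooth coefficients on the finite-dimensional space `E` and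
satisfy the bracket condition on the open set `Ω`, and let the distributions `u_w ∈ 𝓓'(Ω)` solve
`P_w u_w = f_w + ∑_{w'} a_{w w'} u_{w'}` on the open `U ⊆ Ω` with `f_w ∈ C^∞(U)` (tested:
`u_w (ᵗP_w φ) = ∫ f_w φ dμ + ∑_{w'} a_{w w'} u_{w'}(φ)` for `φ ∈ C_c^∞(U)`). Then every `u_w` is a
smooth function on `U`. [folklore] -/
theorem isSmoothOn_of_coupledSystem (hX₀ : ∀ w, ContDiff ℝ ∞ (X₀ w)) (hX : ∀ w j, ContDiff ℝ ∞ (X w j))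
    (hc : ∀ w, ContDiff ℝ ∞ (c w)) {Ω : Opens E}
    (hgen : ∀ w, IsBracketGenerating (fun o : Option ι => o.elim (X₀ w) (X w)) (Ω : Set E))
    (a : W → W → ℝ) (u : W → 𝓓'(Ω, ℝ)) {U : Set E} (hU : IsOpen U) (hUΩ : U ⊆ Ω)
    {f : W → E → ℝ} (hfU : ∀ w, ContDiffOn ℝ ∞ (f w) U)
    (hfu : ∀ w (φ ψ : 𝓓(Ω, ℝ)), tsupport (φ : E → ℝ) ⊆ U →
      (ψ : E → ℝ) = hormanderTranspose (X₀ w) (X w) (c w) φ →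
      u w ψ = (∫ x, f w x * φ x ∂μ) + ∑ w', a w w' * u w' φ) (w₀ : W) :
    IsSmoothOn (u w₀) μ U := by
  by_cases hn : finrank ℝ E = 0
  · haveI : Subsingleton E := Module.finrank_zero_iff.1 hn
    refine isHypoellipticOn_of_subsingleton Ω (fun _ _ => (0 : ℝ)) μ (u w₀) U hU hUΩ
      ⟨0, contDiffOn_const, fun φ ψ _ hψ => ?_⟩
    have h0 : ψ = 0 := by ext y; exact congrFun hψ y
    simp [h0]
  · refine IsSmoothOn.of_locally hUΩ fun x hx => ?_
    have hpos : finrank ℝ (EuclideanSpace ℝ (Fin (finrank ℝ E))) ≠ 0 := by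
      rw [finrank_euclideanSpace_fin]; exact hn
    set T : E ≃L[ℝ] EuclideanSpace ℝ (Fin (finrank ℝ E)) := toEuclidean with hTdef
    have hch : ∀ w, ∃ (m : ℕ) (C : Chart (EuclideanSpace ℝ (Fin (finrank ℝ E))) (Fintype.card ι))
        (_ : C.SpanIn m),
        (∀ i, C.XV i = push T (X w ((Fintype.equivFin ι).symm i))) ∧ C.XV0 = push T (X₀ w) ∧
        (C.cV = fun y => c w (T.symm y)) ∧ C.y₀ = T x := fun w =>
      exists_chartAt (hX₀ w) (hX w) (hc w) (hgen w) T hpos (hUΩ hx)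
    choose m C S hXV hXV0 hcV hy₀ using hch
    -- a radius adapted to `U` and to all chart balls
    have hnhds : (U ∩ ⋂ w, T ⁻¹' ball (C w).y₀ (C w).δ) ∈ 𝓝 x := by
      refine Filter.inter_mem (hU.mem_nhds hx) (Filter.iInter_mem.2 fun w => ?_)
      refine (isOpen_ball.preimage T.continuous).mem_nhds ?_
      show T x ∈ ball (C w).y₀ (C w).δ
      rw [hy₀ w]
      exact mem_ball_self (C w).hδ
    obtain ⟨r, hr, hrsub⟩ := Metric.mem_nhds_iff.1 hnhds
    set ρ : ℝ := r / 4 with hρ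
    have hρ0 : 0 < ρ := by rw [hρ]; positivity
    have h3 : closedBall x (3 * ρ) ⊆ ball x r := closedBall_subset_ball (by rw [hρ]; linarith)
    have h3U : closedBall x (3 * ρ) ⊆ U := (h3.trans hrsub).trans inter_subset_left
    have h3B : ∀ w, closedBall x (3 * ρ) ⊆ T ⁻¹' ball (C w).y₀ (C w).δ := fun w =>
      ((h3.trans hrsub).trans inter_subset_right).trans (iInter_subset _ w)
    refine ⟨ball x ρ, isOpen_ball, mem_ball_self hρ0,
      (ball_subset_closedBall.trans (closedBall_subset_closedBall (by linarith))).trans h3U, ?_⟩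
    exact isSmoothOn_ball_coupled μ hX₀ hX hc T C S (Fintype.equivFin ι) hXV hXV0 hcV a u hU hUΩ hfU hfu
      hρ0 h3U h3B w₀

/-- **Coupled systems for locally integrable functions on the whole space.** If locally integrable
`u_w` solve `∫ u_w ᵗP_w φ dμ = ∫ f_w φ dμ + ∑_{w'} a_{w w'} ∫ u_{w'} φ dμ` for all `φ ∈ C_c^∞(E)`,
with `f_w` smooth and every `P_w` bracket-generating on `E`, then every `u_w` agrees `μ`-a.e. with a
smooth function. [folklore] -/
theorem exists_smooth_ae_eq_of_coupledSystem (hX₀ : ∀ w, ContDiff ℝ ∞ (X₀ w))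
    (hX : ∀ w j, ContDiff ℝ ∞ (X w j)) (hc : ∀ w, ContDiff ℝ ∞ (c w))
    (hgen : ∀ w, IsBracketGenerating (fun o : Option ι => o.elim (X₀ w) (X w)) univ)
    (a : W → W → ℝ) {u : W → E → ℝ} (hu : ∀ w, LocallyIntegrable (u w) μ)
    {f : W → E → ℝ} (hf : ∀ w, ContDiff ℝ ∞ (f w))
    (hweak : ∀ w (φ : E → ℝ), ContDiff ℝ ∞ φ → HasCompactSupport φ →
      ∫ x, u w x * hormanderTranspose (X₀ w) (X w) (c w) φ x ∂μ =
        (∫ x, f w x * φ x ∂μ) + ∑ w', a w w' * ∫ x, u w' x * φ x ∂μ) (w₀ : W) :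
    ∃ g : E → ℝ, ContDiff ℝ ∞ g ∧ u w₀ =ᵐ[μ] g := by
  have huloc : ∀ w, LocallyIntegrableOn (u w) ((⊤ : Opens E) : Set E) μ := fun w =>
    (hu w).locallyIntegrableOn _
  let D : W → 𝓓'((⊤ : Opens E), ℝ) := fun w =>
    (TestFunction.integralAgainstBilinCLM (ContinuousLinearMap.mul ℝ ℝ) μ (u w) : 𝓓((⊤ : Opens E), ℝ) →L[ℝ] ℝ)
  have hD : ∀ w (φ : 𝓓((⊤ : Opens E), ℝ)), D w φ = ∫ x, u w x * φ x ∂μ := by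
    intro w φ
    change TestFunction.integralAgainstBilinCLM (ContinuousLinearMap.mul ℝ ℝ) μ (u w) φ = _
    rw [TestFunction.integralAgainstBilinCLM_eq_integral (huloc w)]
    simp only [ContinuousLinearMap.mul_apply']
    exact integral_congr_ae (ae_of_all _ fun x => mul_comm _ _)
  have hfu : ∀ w (φ ψ : 𝓓((⊤ : Opens E), ℝ)), tsupport (φ : E → ℝ) ⊆ univ →
      (ψ : E → ℝ) = hormanderTranspose (X₀ w) (X w) (c w) φ →
      D w ψ = (∫ x, f w x * φ x ∂μ) + ∑ w', a w w' * D w' φ := by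
    intro w φ ψ _ hψ
    rw [hD, show (fun x => u w x * ψ x) = fun x => u w x * hormanderTranspose (X₀ w) (X w) (c w) φ x by
      ext x; rw [hψ]]
    simp only [hD]
    exact hweak w φ φ.contDiff φ.hasCompactSupport
  obtain ⟨g, hg, hgint⟩ := isSmoothOn_of_coupledSystem μ hX₀ hX hc hgen a D isOpen_univ (subset_univ _)
    (fun w => (hf w).contDiffOn) hfu w₀
  refine ⟨g, contDiffOn_univ.mp hg, ?_⟩
  have hgloc : LocallyIntegrable g μ := (contDiffOn_univ.mp hg).continuous.locallyIntegrable
  refine ae_eq_of_integral_contDiff_smul_eq (hu w₀) hgloc fun φ hφ hφc => ?_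
  let Φ : 𝓓((⊤ : Opens E), ℝ) := ⟨φ, hφ, hφc, fun _ _ => trivial⟩
  have e2 := hgint Φ (subset_univ _)
  rw [hD] at e2
  simp only [smul_eq_mul]
  calc ∫ x, φ x * u w₀ x ∂μ = ∫ x, u w₀ x * Φ x ∂μ :=
        integral_congr_ae (ae_of_all _ fun x => by show φ x * u w₀ x = u w₀ x * φ x; ring)
    _ = ∫ x, g x * Φ x ∂μ := e2
    _ = ∫ x, φ x * g x ∂μ := integral_congr_ae (ae_of_all _ fun x => by show g x * φ x = φ x * g x; ring)

end System

end Literature.Analysis.Hypoelliptic
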